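import Literature.NumberTheory.EllipticCurves.ZpExtensionEisensteinTwistCores
import HarnessLib

/-!
# The twists `M ⊗ A(χ_u)` for a GENERAL coefficient ring `A` (any quotient `Λ ↠ A` in which `1 + T` has
# `p`-power order), their finite-level control maps `H¹(K_n, M) → H¹(K, M ⊗ A(χ_u))`, the dictionary
# `conj_g ↔ u^{−κ̄(g)}`, transitivity, and the CHANGE-OF-COEFFICIENTS maps `M ⊗ A(χ_u) → M′ ⊗ A′(χ_{u′})` along
# `φ : A → A′` (definitions with bodies + theorems; no named fact, no instance, no notation)

Topic `NumberTheory/EllipticCurves`; namespace `Literature.NumberTheory.EllipticCurves.ZpExtension`. The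
GENERIC-COEFFICIENT twin of the tree's `ZpExtensionEisensteinTwistCores` / `ZpExtensionScalarTwistMaps` §3
(D1 lineage of the cell `pub/bsd-print-x9`), which are typed at Howard's Eisenstein coefficient rings
`A_{m,k} = Λ/(T^m + p, p^k)` only. Written by the seat `bsd-line-x9-p2` (g3) for the Λ-ADIC SOURCE of STUB 2 of
the shared μ-item of crux stmt-BirchSwinnertonDyer-27077: by the cell's design ((T3-iii) `CoeffTowerSetting.Hom`,
x9-p1 LEAD g3 RULING 2026-08-28T16:08:30Z (q2)(d), lit g31 16:14:24Z (d)) the SOURCE Λ-adic tower of the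
Kolyvagin-system pushforward must be presented from the same carrier as D1's target, with levels
`𝐓/I𝐓 = E[p^k] ⊗ (Λ/I)(ψ⁻¹)` for open ideals `I` and level maps that are LITERALLY quotient maps of coefficients
— i.e. exactly the objects of this file at `A = Λ/I`, `u = 1 + T mod I`, together with the coefficient change
to `A′ = A_{m,k}`.

WHAT. For a `ℤ_p`-extension `κ`, a discrete Galois module `ρ` on `M`, a commutative ring `A`, `u ∈ A` and
`J` with `u^{p^J} = 1`:
* §0 `coeffTwist κ ρ u J hu : DiscreteGaloisModule K (CoeffExtension ℤ A M)` — `M ⊗ A(χ_u)`,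
  `σ ↦ u^{κ(σ) mod p^J} ⊗ ρ(σ)` (`:= scalarTwist (coeffExtension A ρ) …`); **`coeffTwist_eisenstein`: at
  `A = A_{m,k}`, `u = 1+T`, `J = eisensteinLevel hm k` it IS `κ.eisensteinTwist ρ hm k` (`rfl`)**; unfolding
  lemmas; `coeffTwistSMulHom` (the `A`-action as Galois endomorphisms; `= eisensteinTwistSMulHom`, `rfl`).
* §1 `coeffUnit A : M →+ M ⊗ A`, `a ↦ 1 ⊗ a`, `Γ_J`-equivariant; `coeffUnitHom`.
* §2 **`coresCoeff κ ρ u J hu N hN hNo : H¹(N, M) →+ H¹(K, M ⊗ A(χ_u))`** `:= cor_N^{Γ_K} ∘ H¹(a ↦ 1 ⊗ a)` for an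
  open `N ≤ Γ_J` of finite index (**`= coresEisenstein` at `A_{m,k}`, `rfl`**); on cocycles.
* §3 the dictionary `coresCoeff (g · c) = H¹(u^a •) (coresCoeff c)` for `a ≡ −κ̄_J(g)`; `g ∈ Γ_J` acts
  trivially; `κ̄_J(g) = ∓1` and topological-generator forms.
* §4 transitivity `coresCoeff N′ = coresCoeff N ∘ cor_{N′→N}`.
* §5 **change of coefficients**: for `φ : A →+* A′` with `φ u = u′` (`u′^{p^{J′}} = 1`) and `f : M → M′`:
  `coeffTwistReduceLinear`, **`coeffTwistReduce κ hu hu′ φ hφ f : M ⊗ A(χ_u) →ⁱL M′ ⊗ A′(χ_{u′})`**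
  (pure tensors `c ⊗ a ↦ φ c ⊗ f a`; semilinear; surjective if `φ`, `f` are), and the naturality
  **`map_coeffTwistReduce_coresCoeff`: `H¹(coeffTwistReduce φ f) ∘ coresCoeff_A = coresCoeff_{A′} ∘ H¹(N, f)`**
  — with `A′ = A_{m,k}` the right-hand side is D1's `coresEisenstein ∘ H¹(N, f)` (§2), which is the hook
  «`f k` is literally the quotient map» for the level maps of `CoeffTowerSetting.Hom` from a Λ-adic source.
DEFINITIONS WITH BODIES + theorems; nothing asserted about any curve, Selmer group or `L`-function; no instance, no
notation, no `sorry`. Not here: the `LambdaAdicSelmerData`-level maps `𝔖 → H¹(K, E[p^k] ⊗ (Λ/I)(ψ⁻¹))` and their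
Λ-linearity (sequel files, twins of `LambdaAdicSelmerDataToEisensteinH1[Linear]`), the source `CoeffTowerSetting`.
BSD is not proved by any of this.

References: [Howard2004HeegnerKolyvagin] B. Howard, Compositio Math. 140 (2004), §2.2 (𝐓 = T_p E ⊗ Λ, T_𝔮 = 𝐓 ⊗ S_𝔮,
𝔖 = lim← H¹(K_n, T)), Rem. 1.2.4 (change of coefficient ring), proof of Thm. 2.2.10 (arXiv Thm. 3.2.10, p0017 L78–81:
the map KS(𝐓, F_Λ, 𝓛) → KS(T_𝔭, F_𝔭, 𝓛)); [MazurRubinMemoirs2004] §5.3; [SerreGaloisCohomology1997] I §2.4–§2.5;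
[NeukirchSchmidtWingberg2008] I §5, Prop. 1.5.4; [Washington1997] §13.1–§13.2; [GreenbergLNM1716] §4 p. 105 (twists).
-/

noncomputable section

open scoped TensorProduct Topology ContRepresentation
open Field Filter CategoryTheory

universe u

namespace Literature.NumberTheory.EllipticCurves

open Literature.NumberTheory.GaloisRepresentations

namespace ZpExtension

variable {K : Type u} [Field K] {p : ℕ} [hp : Fact p.Prime] (κ : ZpExtension K p)
variable {M : Type u} [AddCommGroup M] [TopologicalSpace M] [DiscreteTopology M]
variable (ρ : DiscreteGaloisModule K M) {A : Type} [CommRing A] {u : A} {J : ℕ} (hu : u ^ (p ^ J) = 1)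

/-! ## §0 The twist `M ⊗ A(χ_u)` for a general coefficient ring -/

omit hp in
include hu in
/-- `u^{p^J} = 1` makes `u^{p^J}` act trivially on every `A`-module. [cite: Washington1997, §13.1–§13.2] -/
theorem forall_pow_prime_pow_smul_eq_self {N : Type*} [AddCommGroup N] [Module A N] :
    ∀ x : N, u ^ (p ^ J) • x = x := fun x ↦ by
  rw [hu, one_smul]

omit [TopologicalSpace M] [DiscreteTopology M] hp in
/-- Scalars pass into the first factor of a pure tensor: `c′ • (c ⊗ a) = (c′ c) ⊗ a`.
[cite: Howard2004HeegnerKolyvagin, §2.2 (T_𝔮 = 𝐓 ⊗_Λ S_𝔮)] -/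
theorem coeff_smul_tmul (c' c : A) (a : M) :
    c' • (CoeffExtension.tmul c a : CoeffExtension ℤ A M) = CoeffExtension.tmul (c' * c) a :=
  TensorProduct.smul_tmul' c' c a

/-- **The twist `M ⊗ A(χ_u)`** of a discrete Galois module `M` by the character `χ_u : σ ↦ u^{κ(σ)}` with values
in a commutative coefficient ring `A` (`u^{p^J} = 1`): the discrete Galois module `A ⊗_ℤ M` with
`σ ↦ u^{κ(σ) mod p^J} ⊗ ρ(σ)` — the tree's `scalarTwist` of `coeffExtension A ρ`. For `A = Λ/I` (`I` open,
`ω_J ∈ I`), `u = 1 + T`, `M = E[p^k]` this is the level `𝐓/I𝐓 ⊗ ℤ/p^k = E[p^k] ⊗ (Λ/I)(ψ)` of Howard's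
`𝐓 = T_p E ⊗ Λ(ψ)`; for `A = A_{m,k}` it is `eisensteinTwist` (`coeffTwist_eisenstein`).
[cite: Howard2004HeegnerKolyvagin, §2.2 (𝐓 = T_p E ⊗_{ℤ_p} Λ, Γ_K acting on Λ through γ ↦ 1 + T)]
[cite: GreenbergLNM1716, §4 p. 105 (the twisted modules A_s)] -/
def coeffTwist (u : A) (J : ℕ) (hu : u ^ (p ^ J) = 1) : DiscreteGaloisModule K (CoeffExtension ℤ A M) :=
  κ.scalarTwist (DiscreteGaloisModule.coeffExtension A ρ) (DiscreteGaloisModule.coeffExtension_apply_smul A ρ)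
    J u (forall_pow_prime_pow_smul_eq_self (p := p) hu)

/-- **At the Eisenstein coefficient ring `A_{m,k}` the generic twist IS Howard's `M ⊗ A_{m,k}(ψ)`**
(`eisensteinTwist`, definitionally). [cite: Howard2004HeegnerKolyvagin, §2.2 and proof of Thm. 2.2.10 (𝔮 = T^m + p)] -/
theorem coeffTwist_eisenstein {m : ℕ} (hm : 1 ≤ m) (k : ℕ) :
    κ.coeffTwist ρ (IwasawaAlgebra.EisensteinCoeff.onePlusT p m k) (eisensteinLevel (p := p) hm k)
      (onePlusT_pow_prime_pow_eisensteinLevel (p := p) hm k) = κ.eisensteinTwist ρ hm k :=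
  rfl

/-- Unfolding `coeffTwist`: `σ · x = u^{κ(σ) mod p^J} • (1 ⊗ ρ(σ)) x`. [cite: Howard2004HeegnerKolyvagin, §2.2] -/
theorem coeffTwist_apply_apply (σ : absoluteGaloisGroup K) (x : CoeffExtension ℤ A M) :
    κ.coeffTwist ρ u J hu σ x = u ^ κ.twistExponent J σ • DiscreteGaloisModule.coeffExtension A ρ σ x :=
  rfl

/-- **Action on pure tensors**: `σ · (c ⊗ a) = (u^{κ(σ) mod p^J} c) ⊗ ρ(σ) a`. [cite: Howard2004HeegnerKolyvagin, §2.2] -/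
theorem coeffTwist_apply_tmul (σ : absoluteGaloisGroup K) (c : A) (a : M) :
    κ.coeffTwist ρ u J hu σ (CoeffExtension.tmul c a) =
      CoeffExtension.tmul (u ^ κ.twistExponent J σ * c) (ρ σ a) := by
  rw [coeffTwist_apply_apply, DiscreteGaloisModule.coeffExtension_apply_tmul, coeff_smul_tmul]

/-- `Gal(K̄/K_J)` acts through `1 ⊗ ρ`. [cite: Washington1997, §13.1–§13.2] -/
theorem coeffTwist_apply_of_mem_layerSubgroup {σ : absoluteGaloisGroup K} (hσ : σ ∈ κ.layerSubgroup J)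
    (x : CoeffExtension ℤ A M) :
    κ.coeffTwist ρ u J hu σ x = DiscreteGaloisModule.coeffExtension A ρ σ x := by
  unfold coeffTwist
  rw [κ.scalarTwist_apply_of_mem_layerSubgroup _ _ _ _ _ hσ]

/-- `Gal(K̄/K_∞) = ker κ` acts through `ρ`: `σ · (c ⊗ a) = c ⊗ ρ(σ) a`. [cite: Howard2004HeegnerKolyvagin, §2.2] -/
theorem coeffTwist_apply_tmul_of_mem_kerSubgroup {σ : absoluteGaloisGroup K} (hσ : σ ∈ κ.kerSubgroup) (c : A)
    (a : M) : κ.coeffTwist ρ u J hu σ (CoeffExtension.tmul c a) = CoeffExtension.tmul c (ρ σ a) := by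
  unfold coeffTwist
  rw [κ.scalarTwist_apply_of_mem_kerSubgroup _ _ _ _ _ hσ]
  exact DiscreteGaloisModule.coeffExtension_apply_tmul _ ρ σ c a

/-- A topological generator `γ` acts by `u ⊗ ρ(γ)`. [cite: Howard2004HeegnerKolyvagin, §2.2 (γ ↦ 1 + T)] -/
theorem coeffTwist_apply_tmul_of_isTopGenerator {γ : absoluteGaloisGroup K} (hγ : κ.IsTopGenerator γ) (c : A)
    (a : M) : κ.coeffTwist ρ u J hu γ (CoeffExtension.tmul c a) = CoeffExtension.tmul (u * c) (ρ γ a) := by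
  unfold coeffTwist
  rw [κ.scalarTwist_apply_of_isTopGenerator _ _ _ _ _ hγ, DiscreteGaloisModule.coeffExtension_apply_tmul,
    coeff_smul_tmul]

/-- `Γ_K` acts `A`-linearly on `M ⊗ A(χ_u)`. [cite: Howard2004HeegnerKolyvagin, §2.2] -/
theorem coeffTwist_apply_smul (σ : absoluteGaloisGroup K) (c : A) (x : CoeffExtension ℤ A M) :
    κ.coeffTwist ρ u J hu σ (c • x) = c • κ.coeffTwist ρ u J hu σ x := by
  unfold coeffTwist
  exact κ.scalarTwist_apply_smul _ _ _ _ _ σ c x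

/-- **Multiplication by `c ∈ A` is an endomorphism of `M ⊗ A(χ_u)`**, as a continuous intertwining map (through
`galoisCohomology.map`, `H^n(K, M ⊗ A(χ_u))` is an `A`-module). [cite: Howard2004HeegnerKolyvagin, §2.2] -/
def coeffTwistSMulHom (c : A) :
    (κ.coeffTwist ρ u J hu).toContRepresentation →ⁱL (κ.coeffTwist ρ u J hu).toContRepresentation where
  toContinuousLinearMap :=
    ⟨(DistribSMul.toAddMonoidHom (CoeffExtension ℤ A M) c).toIntLinearMap, continuous_of_discreteTopology⟩
  isIntertwining' σ := by
    ext x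
    exact (κ.coeffTwist_apply_smul ρ hu σ c x).symm

/-- Unfolding `coeffTwistSMulHom`: it is `x ↦ c • x`. [cite: Howard2004HeegnerKolyvagin, §2.2] -/
@[simp]
theorem coeffTwistSMulHom_apply (c : A) (x : CoeffExtension ℤ A M) : κ.coeffTwistSMulHom ρ hu c x = c • x :=
  rfl

/-- At `A = A_{m,k}`, `coeffTwistSMulHom` IS `eisensteinTwistSMulHom` (definitionally).
[cite: Howard2004HeegnerKolyvagin, §2.2] -/
theorem coeffTwistSMulHom_eisenstein {m : ℕ} (hm : 1 ≤ m) (k : ℕ) (c : IwasawaAlgebra.EisensteinCoeff p m k) :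
    κ.coeffTwistSMulHom ρ (onePlusT_pow_prime_pow_eisensteinLevel (p := p) hm k) c =
      κ.eisensteinTwistSMulHom ρ hm k c :=
  rfl

/-! ## §1 `M → M ⊗ A`, `a ↦ 1 ⊗ a`, a `Γ_J`-equivariant map -/

section Unit

variable (A) in
/-- **`M → M ⊗ A`, `a ↦ 1 ⊗ a`** (the map `T/p^k T → 𝐓/I𝐓 ⊗ ℤ/p^k` induced by `ℤ_p → Λ/I` at finite level).
[cite: Howard2004HeegnerKolyvagin, §2.2] [cite: SerreGaloisCohomology1997, I §2.5] -/
def coeffUnit : M →+ CoeffExtension ℤ A M where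
  toFun a := CoeffExtension.tmul 1 a
  map_zero' := TensorProduct.tmul_zero _ _
  map_add' _ _ := TensorProduct.tmul_add _ _ _

omit [TopologicalSpace M] [DiscreteTopology M] in
/-- Unfolding `coeffUnit`: `coeffUnit a = 1 ⊗ a`. [cite: Howard2004HeegnerKolyvagin, §2.2] -/
@[simp]
theorem coeffUnit_apply (a : M) : coeffUnit A a = CoeffExtension.tmul (1 : A) a :=
  rfl

omit [TopologicalSpace M] [DiscreteTopology M] in
/-- At `A = A_{m,k}`, `coeffUnit` IS `eisensteinUnitCoeff` (definitionally). [cite: Howard2004HeegnerKolyvagin, §2.2] -/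
theorem coeffUnit_eisenstein (m k : ℕ) (a : M) :
    coeffUnit (IwasawaAlgebra.EisensteinCoeff p m k) a = eisensteinUnitCoeff p m k a :=
  rfl

/-- **`g ∈ Γ_K` acts on `1 ⊗ a` by `u^{κ(g) mod p^J} • (1 ⊗ ρ(g) a)`.** [cite: Howard2004HeegnerKolyvagin, §2.2] -/
theorem coeffTwist_coeffUnit (g : absoluteGaloisGroup K) (a : M) :
    κ.coeffTwist ρ u J hu g (coeffUnit A a) = u ^ κ.twistExponent J g • coeffUnit A (ρ g a) := by
  rw [coeffUnit_apply, coeffUnit_apply, κ.coeffTwist_apply_tmul ρ hu, coeff_smul_tmul]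

/-- **`Γ_J` acts on `1 ⊗ M` through `ρ`**: `g · (1 ⊗ a) = 1 ⊗ ρ(g) a` for `g ∈ Γ_J`. [cite: Washington1997, §13.1–§13.2] -/
theorem coeffTwist_coeffUnit_of_mem {g : absoluteGaloisGroup K} (hg : g ∈ κ.layerSubgroup J) (a : M) :
    κ.coeffTwist ρ u J hu g (coeffUnit A a) = coeffUnit A (ρ g a) := by
  rw [coeffTwist_coeffUnit, κ.twistExponent_eq_zero_of_mem_layerSubgroup hg, pow_zero, one_smul]

/-- **`u^a • (g · (1 ⊗ x)) = 1 ⊗ ρ(g) x` when `a ≡ −κ̄_J(g) (mod p^J)`** (`u^{p^J} = 1`).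
[cite: Washington1997, §13.1–§13.2] [cite: Howard2004HeegnerKolyvagin, §2.2] -/
theorem smul_coeffTwist_coeffUnit (g : absoluteGaloisGroup K) {a : ℕ}
    (ha : (a : ZMod (p ^ J)) = -κ.layerIndex J g) (x : M) :
    u ^ a • κ.coeffTwist ρ u J hu g (coeffUnit A x) = coeffUnit A (ρ g x) := by
  rw [coeffTwist_coeffUnit, smul_smul, ← pow_add]
  have hdvd : p ^ J ∣ a + κ.twistExponent J g := by
    rw [← ZMod.natCast_eq_zero_iff, Nat.cast_add, ha, κ.natCast_twistExponent J J le_rfl, neg_add_cancel]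
  obtain ⟨q, hq⟩ := hdvd
  rw [hq, pow_mul, hu, one_pow, one_smul]

variable (N : Subgroup (absoluteGaloisGroup K)) (hN : N ≤ κ.layerSubgroup J)

/-- **`a ↦ 1 ⊗ a` as a morphism `M|_N ⟶ (M ⊗ A(χ_u))|_N`** of topological representations of a subgroup
`N ≤ Γ_J` (intended `N = Γ_n`, `n ≥ J`, a layer of `κ` or of `κ.unitTwist u₀`).
[cite: SerreGaloisCohomology1997, I §2.5] [cite: Howard2004HeegnerKolyvagin, §2.2] -/
def coeffUnitHom : subgroupRep ρ.toTopRep N ⟶ subgroupRep (κ.coeffTwist ρ u J hu).toTopRep N :=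
  TopRep.ofHom
    ⟨{ toFun := coeffUnit A
       map_add' := map_add _
       map_smul' := fun c a ↦ by simp only [map_zsmul, RingHom.id_apply]
       cont := continuous_of_discreteTopology },
      fun g ↦ ContinuousLinearMap.ext fun a ↦ (κ.coeffTwist_coeffUnit_of_mem ρ hu (hN g.2) a).symm⟩

/-- `coeffUnitHom` is `a ↦ 1 ⊗ a` on elements. [cite: SerreGaloisCohomology1997, I §2.5] -/
@[simp]
theorem coeffUnitHom_hom_apply (a : M) : (κ.coeffUnitHom ρ hu N hN).hom a = coeffUnit A a :=
  rfl

end Unit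

/-! ## §2 The finite-level control map `coresCoeff N = cor_N^{Γ_K} ∘ H¹(a ↦ 1 ⊗ a)` -/

section Cores

variable (N : Subgroup (absoluteGaloisGroup K)) (hN : N ≤ κ.layerSubgroup J) (hNo : IsOpen (N : Set (absoluteGaloisGroup K)))

/-- **`coresCoeff N : H¹(N, M) →+ H¹(Γ_K, M ⊗ A(χ_u))`, `c ↦ cor_N^{Γ_K}(H¹(a ↦ 1 ⊗ a)(c))`** for an open
subgroup `N ≤ Γ_J` of finite index (`N = Γ_n`, `n ≥ J`): the level-`(n, I)` component of Howard's
`𝔖 = lim←_n H¹(K_n, T_p E) ≅ H¹(K, 𝐓) → H¹(K, 𝐓/I𝐓 ⊗ ℤ/p^k)` (Serre's Cor through the induced module). At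
`A = A_{m,k}` this IS `coresEisenstein` (`coresCoeff_eisenstein`).
[cite: Howard2004HeegnerKolyvagin, §2.2 (𝔖 ≅ H¹(K, 𝐓)) and Rem. 1.2.4] [cite: SerreGaloisCohomology1997, I §2.5 Prop. 10 and (b)] -/
def coresCoeff [Fintype (absoluteGaloisGroup K ⧸ N)] :
    continuousCohomology 1 (subgroupRep ρ.toTopRep N) →+ galoisCohomology (κ.coeffTwist ρ u J hu) 1 :=
  (cores (κ.coeffTwist ρ u J hu).toTopRep N hNo).toAddMonoidHom.comp
    (cohomologyMap (κ.coeffUnitHom ρ hu N hN) 1).hom.toLinearMap.toAddMonoidHom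

/-- Unfolding `coresCoeff`: `cores ∘ H¹(coeffUnitHom)`. [cite: SerreGaloisCohomology1997, I §2.5] -/
theorem coresCoeff_apply [Fintype (absoluteGaloisGroup K ⧸ N)] (c : continuousCohomology 1 (subgroupRep ρ.toTopRep N)) :
    κ.coresCoeff ρ hu N hN hNo c =
      cores (κ.coeffTwist ρ u J hu).toTopRep N hNo (cohomologyMap (κ.coeffUnitHom ρ hu N hN) 1 c) :=
  rfl

/-- **At `A = A_{m,k}`, `coresCoeff` IS D1's `coresEisenstein`** (definitionally).
[cite: Howard2004HeegnerKolyvagin, §2.2, Lemma 2.2.7 and Prop. 2.2.8] -/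
theorem coresCoeff_eisenstein {m : ℕ} (hm : 1 ≤ m) (k : ℕ) (hN' : N ≤ κ.layerSubgroup (eisensteinLevel (p := p) hm k))
    [Fintype (absoluteGaloisGroup K ⧸ N)] :
    κ.coresCoeff ρ (onePlusT_pow_prime_pow_eisensteinLevel (p := p) hm k) N hN' hNo =
      κ.coresEisenstein ρ hm k N hN' hNo :=
  rfl

/-- `coresCoeff` on explicit cocycles: the class of the transfer of `x ↦ 1 ⊗ φ(x)`.
[cite: SerreGaloisCohomology1997, I §2.5] [cite: NeukirchSchmidtWingberg2008, I §5] -/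
theorem coresCoeff_oneCocycleClass [Fintype (absoluteGaloisGroup K ⧸ N)]
    {s : absoluteGaloisGroup K ⧸ N → absoluteGaloisGroup K} (hs : ∀ x, (s x : absoluteGaloisGroup K ⧸ N) = x)
    (φ : contOneCocycles (subgroupRep ρ.toTopRep N)) :
    κ.coresCoeff ρ hu N hN hNo (oneCocycleClass _ φ) =
      oneCocycleClass (κ.coeffTwist ρ u J hu).toTopRep
        (transferCocycle (κ.coeffTwist ρ u J hu).toTopRep N hNo hs
          (contOneCocycles.pullback (ContinuousMonoidHom.id _) (resIdHom (κ.coeffUnitHom ρ hu N hN)) φ)) := by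
  rw [coresCoeff_apply, cohomologyMap_oneCocycleClass, cores_oneCocycleClass _ _ _ hs]

end Cores

/-! ## §3 The dictionary `conj_g ↔ u^{−κ̄_J(g)}` -/

section ConjDictionary

variable (N : Subgroup (absoluteGaloisGroup K)) [N.Normal] (hN : N ≤ κ.layerSubgroup J)
  (hNo : IsOpen (N : Set (absoluteGaloisGroup K))) [Fintype (absoluteGaloisGroup K ⧸ N)]

/-- **`coresCoeff (g · c) = H¹(u^a •) (coresCoeff c)` for `a ≡ −κ̄_J(g) (mod p^J)`** (`g ∈ Γ_K`, `c ∈ H¹(N, M)`,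
`N ⊴ Γ_K` open of finite index, `N ≤ Γ_J`): on cocycles `1 ⊗ (g·φ) = u^a • (g · (1 ⊗ φ))`, `cor` commutes with
`u^a •` and `cor (g · y) = cor y`. [cite: SerreGaloisCohomology1997, I §2.5 (b) and Exercise 1]
[cite: NeukirchSchmidtWingberg2008, Prop. 1.5.4] [cite: Howard2004HeegnerKolyvagin, §2.2 (𝔖 = H¹(K, 𝐓) as a Λ-module)] -/
theorem coresCoeff_conjMap (g : absoluteGaloisGroup K) {a : ℕ} (ha : (a : ZMod (p ^ J)) = -κ.layerIndex J g)
    (c : continuousCohomology 1 (subgroupRep ρ.toTopRep N)) :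
    κ.coresCoeff ρ hu N hN hNo (conjMap ρ.toTopRep N g 1 c) =
      galoisCohomology.map (κ.coeffTwistSMulHom ρ hu (u ^ a)) 1 (κ.coresCoeff ρ hu N hN hNo c) := by
  classical
  obtain ⟨φ, rfl⟩ := oneCocycleClass_surjective _ c
  set F : (κ.coeffTwist ρ u J hu).toTopRep ⟶ (κ.coeffTwist ρ u J hu).toTopRep :=
    TopRep.ofHom ⟨(κ.coeffTwistSMulHom ρ hu (u ^ a)).toContinuousLinearMap,
      (κ.coeffTwistSMulHom ρ hu (u ^ a)).isIntertwining'⟩ with hF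
  have hcocycle :
      contOneCocycles.pullback (ContinuousMonoidHom.id _) (resIdHom (κ.coeffUnitHom ρ hu N hN))
          (contOneCocycles.pullback (subgroupConj N g) (conjRepHom ρ.toTopRep N g) φ) =
        contOneCocycles.pullback (ContinuousMonoidHom.id _) (resIdHom (subgroupRepHom F N))
          (contOneCocycles.pullback (subgroupConj N g) (conjRepHom (κ.coeffTwist ρ u J hu).toTopRep N g)
            (contOneCocycles.pullback (ContinuousMonoidHom.id _) (resIdHom (κ.coeffUnitHom ρ hu N hN)) φ)) := by
    refine Subtype.ext (ContinuousMap.ext fun x ↦ ?_)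
    rw [pullback_id_resIdHom_apply, conj_pullback_apply, pullback_id_resIdHom_apply,
      conj_pullback_apply, pullback_id_resIdHom_apply, coeffUnitHom_hom_apply, coeffUnitHom_hom_apply,
      subgroupRepHom_hom_apply, ContinuousRep.toTopRep_ρ_apply, ContinuousRep.toTopRep_ρ_apply]
    exact (κ.smul_coeffTwist_coeffUnit ρ hu g ha _).symm
  rw [conjMap_oneCocycleClass]
  change cores _ _ _ (cohomologyMap (κ.coeffUnitHom ρ hu N hN) 1 (oneCocycleClass _ _)) =
    cohomologyMap F 1 (cores _ _ _ (cohomologyMap (κ.coeffUnitHom ρ hu N hN) 1 (oneCocycleClass _ φ)))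
  conv_lhs => rw [cohomologyMap_oneCocycleClass, hcocycle, ← cohomologyMap_oneCocycleClass,
    ← conjMap_oneCocycleClass, ← cohomologyMap_oneCocycleClass]
  rw [← cohomologyMap_cores, cores_conjMap]

/-- **`Γ_J` acts trivially after `coresCoeff`** (the case `a = 0`). [cite: SerreGaloisCohomology1997, I §2.5 (b)] -/
theorem coresCoeff_conjMap_of_mem {g : absoluteGaloisGroup K} (hg : g ∈ κ.layerSubgroup J)
    (c : continuousCohomology 1 (subgroupRep ρ.toTopRep N)) :
    κ.coresCoeff ρ hu N hN hNo (conjMap ρ.toTopRep N g 1 c) = κ.coresCoeff ρ hu N hN hNo c := by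
  have ha : ((0 : ℕ) : ZMod (p ^ J)) = -κ.layerIndex J g := by
    rw [Nat.cast_zero, (κ.layerIndex_eq_zero_iff _ g).2 hg, neg_zero]
  rw [κ.coresCoeff_conjMap ρ hu N hN hNo g ha c, pow_zero]
  obtain ⟨ψ, hψ⟩ := oneCocycleClass_surjective _ (κ.coresCoeff ρ hu N hN hNo c)
  rw [← hψ]
  change cohomologyMap (TopRep.ofHom ⟨(κ.coeffTwistSMulHom ρ hu 1).toContinuousLinearMap,
      (κ.coeffTwistSMulHom ρ hu 1).isIntertwining'⟩) 1 (oneCocycleClass _ ψ) = oneCocycleClass _ ψ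
  rw [cohomologyMap_oneCocycleClass]
  refine congrArg _ (Subtype.ext (ContinuousMap.ext fun x ↦ ?_))
  rw [pullback_id_resIdHom_apply]
  change (1 : A) • ψ.1 x = ψ.1 x
  exact one_smul _ _

/-- **`κ̄_J(g) = −1` ⇒ `coresCoeff (g · c) = u • coresCoeff c`** (`a = 1`; e.g. `g = γ⁻¹`, or `g = γ` for the
inverse extension — the convention making the Λ-adic control map Λ-LINEAR).
[cite: SerreGaloisCohomology1997, I §2.5 (b) and Exercise 1] [cite: Washington1997, §13.1–§13.2] -/
theorem coresCoeff_conjMap_of_layerIndex_eq_neg_one {g : absoluteGaloisGroup K} (hg : κ.layerIndex J g = -1)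
    (c : continuousCohomology 1 (subgroupRep ρ.toTopRep N)) :
    κ.coresCoeff ρ hu N hN hNo (conjMap ρ.toTopRep N g 1 c) =
      galoisCohomology.map (κ.coeffTwistSMulHom ρ hu u) 1 (κ.coresCoeff ρ hu N hN hNo c) := by
  have ha : ((1 : ℕ) : ZMod (p ^ J)) = -κ.layerIndex J g := by rw [Nat.cast_one, hg, neg_neg]
  rw [κ.coresCoeff_conjMap ρ hu N hN hNo g ha c, pow_one]

/-- **`κ̄_J(g) = 1` ⇒ `coresCoeff (g · c) = u^{p^J − 1} • coresCoeff c`** (`u^{p^J−1} = u^{−1}`).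
[cite: SerreGaloisCohomology1997, I §2.5 (b) and Exercise 1] [cite: Washington1997, §13.1–§13.2] -/
theorem coresCoeff_conjMap_of_layerIndex_eq_one {g : absoluteGaloisGroup K} (hg : κ.layerIndex J g = 1)
    (c : continuousCohomology 1 (subgroupRep ρ.toTopRep N)) :
    κ.coresCoeff ρ hu N hN hNo (conjMap ρ.toTopRep N g 1 c) =
      galoisCohomology.map (κ.coeffTwistSMulHom ρ hu (u ^ (p ^ J - 1))) 1 (κ.coresCoeff ρ hu N hN hNo c) := by
  refine κ.coresCoeff_conjMap ρ hu N hN hNo g ?_ c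
  rw [hg, Nat.cast_sub (Nat.one_le_pow _ _ hp.out.pos), ZMod.natCast_self, zero_sub, Nat.cast_one]

/-- A topological generator `γ` of `κ` acts as `u^{p^J − 1} •` after `coresCoeff`. [cite: Washington1997, §13.1–§13.2] -/
theorem coresCoeff_conjMap_of_isTopGenerator {γ : absoluteGaloisGroup K} (hγ : κ.IsTopGenerator γ)
    (c : continuousCohomology 1 (subgroupRep ρ.toTopRep N)) :
    κ.coresCoeff ρ hu N hN hNo (conjMap ρ.toTopRep N γ 1 c) =
      galoisCohomology.map (κ.coeffTwistSMulHom ρ hu (u ^ (p ^ J - 1))) 1 (κ.coresCoeff ρ hu N hN hNo c) :=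
  κ.coresCoeff_conjMap_of_layerIndex_eq_one ρ hu N hN hNo (κ.layerIndex_eq_one_of_isTopGenerator _ hγ) c

/-- The inverse `γ⁻¹` of a topological generator acts as `u •` after `coresCoeff`. [cite: Washington1997, §13.1–§13.2] -/
theorem coresCoeff_conjMap_inv_of_isTopGenerator {γ : absoluteGaloisGroup K} (hγ : κ.IsTopGenerator γ)
    (c : continuousCohomology 1 (subgroupRep ρ.toTopRep N)) :
    κ.coresCoeff ρ hu N hN hNo (conjMap ρ.toTopRep N γ⁻¹ 1 c) =
      galoisCohomology.map (κ.coeffTwistSMulHom ρ hu u) 1 (κ.coresCoeff ρ hu N hN hNo c) :=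
  κ.coresCoeff_conjMap_of_layerIndex_eq_neg_one ρ hu N hN hNo
    (by rw [layerIndex_inv, κ.layerIndex_eq_one_of_isTopGenerator _ hγ]) c

end ConjDictionary

/-! ## §4 Transitivity in the subgroup -/

section Level

/-- **`coresCoeff N′ = coresCoeff N ∘ cor_{N′ → N}`** for open subgroups `N′ ≤ N ≤ Γ_J` of finite index (so
`coresCoeff Γ_n x_n` is independent of `n ≥ J` on a corestriction-compatible family).
[cite: SerreGaloisCohomology1997, I §2.4 and §2.5 (b)] [cite: Howard2004HeegnerKolyvagin, §2.2 (𝔖 = lim← H¹(K_n, T))] -/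
theorem coresCoeff_coresLe {N N' : Subgroup (absoluteGaloisGroup K)} (hN : N ≤ κ.layerSubgroup J) (hN'N : N' ≤ N)
    (hNo : IsOpen (N : Set (absoluteGaloisGroup K))) (hN'o : IsOpen (N' : Set (absoluteGaloisGroup K)))
    [Fintype (absoluteGaloisGroup K ⧸ N)] [Fintype (absoluteGaloisGroup K ⧸ N')] [Fintype (N ⧸ N'.subgroupOf N)]
    (c : continuousCohomology 1 (subgroupRep ρ.toTopRep N')) :
    κ.coresCoeff ρ hu N' (hN'N.trans hN) hN'o c =
      κ.coresCoeff ρ hu N hN hNo (coresLe ρ.toTopRep hN'N hN'o c) := by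
  have hR : κ.coresCoeff ρ hu N hN hNo (coresLe ρ.toTopRep hN'N hN'o c) =
      cores (κ.coeffTwist ρ u J hu).toTopRep N' hN'o
        (cohomologyMap (restrictHomOfLe (X := ρ.toTopRep) (Y := (κ.coeffTwist ρ u J hu).toTopRep)
          (H := N') (H' := N) hN'N (κ.coeffUnitHom ρ hu N hN)) 1 c) := by
    rw [coresCoeff_apply, cohomologyMap_coresLe, cores_coresLe_eq_cores]
  rw [hR, coresCoeff_apply]
  obtain ⟨φ, rfl⟩ := oneCocycleClass_surjective _ c
  rw [cohomologyMap_oneCocycleClass, cohomologyMap_oneCocycleClass]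
  refine congrArg _ (congrArg _ (Subtype.ext (ContinuousMap.ext fun x ↦ ?_)))
  rw [pullback_id_resIdHom_apply, pullback_id_resIdHom_apply, restrictHomOfLe_hom_apply,
    coeffUnitHom_hom_apply, coeffUnitHom_hom_apply]

end Level

/-! ## §5 Change of coefficients `M ⊗ A(χ_u) → M′ ⊗ A′(χ_{u′})` along `φ : A → A′` and `f : M → M′` -/

section Reduce

variable {A' : Type} [CommRing A'] {u' : A'} {J' : ℕ} (hu' : u' ^ (p ^ J') = 1)
  (φ : A →+* A') (hφ : φ u = u')
  {M' : Type u} [AddCommGroup M'] [TopologicalSpace M'] [DiscreteTopology M'] {ρ} {ρ' : DiscreteGaloisModule K M'}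

/-- The underlying additive map of the coefficient change: `c ⊗ a ↦ φ c ⊗ f a`.
[cite: Howard2004HeegnerKolyvagin, Rem. 1.2.4 (change of coefficient ring R → R′)] -/
def coeffTwistReduceLinear (f : M →ₗ[ℤ] M') : CoeffExtension ℤ A M →ₗ[ℤ] CoeffExtension ℤ A' M' :=
  (TensorProduct.map φ.toAddMonoidHom.toIntLinearMap f : A ⊗[ℤ] M →ₗ[ℤ] A' ⊗[ℤ] M')

omit [TopologicalSpace M] [DiscreteTopology M] [TopologicalSpace M'] [DiscreteTopology M'] in
/-- `coeffTwistReduceLinear` on pure tensors. [cite: Howard2004HeegnerKolyvagin, Rem. 1.2.4] -/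
@[simp]
theorem coeffTwistReduceLinear_tmul (f : M →ₗ[ℤ] M') (c : A) (a : M) :
    coeffTwistReduceLinear φ f (CoeffExtension.tmul c a) = CoeffExtension.tmul (φ c) (f a) :=
  TensorProduct.map_tmul _ _ _ _

omit [TopologicalSpace M] [DiscreteTopology M] [TopologicalSpace M'] [DiscreteTopology M'] in
/-- `coeffTwistReduceLinear` is semilinear along `φ`: `r(c • x) = φ c • r(x)`. [cite: Howard2004HeegnerKolyvagin, Rem. 1.2.4] -/
theorem coeffTwistReduceLinear_smul (f : M →ₗ[ℤ] M') (c : A) (x : CoeffExtension ℤ A M) :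
    coeffTwistReduceLinear φ f (c • x) = φ c • coeffTwistReduceLinear φ f x := by
  induction x using CoeffExtension.induction_on with
  | zero => rw [smul_zero, map_zero, smul_zero]
  | tmul c' a =>
    rw [coeff_smul_tmul, coeffTwistReduceLinear_tmul, coeffTwistReduceLinear_tmul, coeff_smul_tmul, map_mul]
  | add x y hx hy => rw [smul_add, map_add, hx, hy, map_add, smul_add]

/-- **The change-of-coefficients map `M ⊗ A(χ_u) → M′ ⊗ A′(χ_{u′})`** along a ring map `φ : A → A′` with
`φ u = u′` and a morphism `f : M → M′` of discrete Galois modules — a morphism of the twisted discrete Galois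
modules (the exponent levels `J`, `J′` being interchangeable as `u′^{p^J} = u′^{p^{J′}} = 1`). For `A = Λ/I`,
`A′ = Λ/I′` (`I ≤ I′`) or `A′ = A_{m,k}` and `f = (p^{k′−k}) : E[p^{k′}] → E[p^k]` these are the LEVEL / QUOTIENT maps
`𝐓/I𝐓 ⊗ ℤ/p^{k′} → 𝐓/I′𝐓 ⊗ ℤ/p^k` of the Λ-adic tower and of Howard's ring change `Λ → S_𝔮`.
[cite: Howard2004HeegnerKolyvagin, Rem. 1.2.4 (R → R′) and §2.2, Lemma 2.2.7] [cite: MazurRubinMemoirs2004, §5.3] -/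
def coeffTwistReduce (f : ρ.toContRepresentation →ⁱL ρ'.toContRepresentation) :
    (κ.coeffTwist ρ u J hu).toContRepresentation →ⁱL (κ.coeffTwist ρ' u' J' hu').toContRepresentation where
  toContinuousLinearMap :=
    ⟨coeffTwistReduceLinear φ f.toContinuousLinearMap.toLinearMap, continuous_of_discreteTopology⟩
  isIntertwining' σ := by
    ext x
    change coeffTwistReduceLinear φ f.toContinuousLinearMap.toLinearMap (κ.coeffTwist ρ u J hu σ x) =
      κ.coeffTwist ρ' u' J' hu' σ (coeffTwistReduceLinear φ f.toContinuousLinearMap.toLinearMap x)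
    induction x using CoeffExtension.induction_on with
    | zero => simp only [map_zero]
    | tmul c a =>
      have hJ : u' ^ (p ^ J) = 1 := by rw [← hφ, ← map_pow, hu, map_one]
      rw [coeffTwist_apply_tmul, coeffTwistReduceLinear_tmul, coeffTwistReduceLinear_tmul, coeffTwist_apply_tmul,
        map_mul, map_pow, hφ, κ.pow_twistExponent_eq_of_pow_eq_one hJ hu' σ]
      congr 1
      exact congrArg (fun g ↦ g a) (f.isIntertwining' σ)
    | add x y hx hy => rw [map_add, map_add, hx, hy, map_add, map_add]

/-- Unfolding `coeffTwistReduce` on pure tensors: `c ⊗ a ↦ φ c ⊗ f a`. [cite: Howard2004HeegnerKolyvagin, Rem. 1.2.4] -/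
@[simp]
theorem coeffTwistReduce_tmul (f : ρ.toContRepresentation →ⁱL ρ'.toContRepresentation) (c : A) (a : M) :
    κ.coeffTwistReduce hu hu' φ hφ f (CoeffExtension.tmul c a) = CoeffExtension.tmul (φ c) (f a) :=
  coeffTwistReduceLinear_tmul φ _ c a

/-- `coeffTwistReduce` is semilinear along `φ` (so on cohomology it is Λ-linear for quotients of Λ).
[cite: Howard2004HeegnerKolyvagin, Rem. 1.2.4] -/
theorem coeffTwistReduce_smul (f : ρ.toContRepresentation →ⁱL ρ'.toContRepresentation) (c : A)
    (x : CoeffExtension ℤ A M) :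
    κ.coeffTwistReduce hu hu' φ hφ f (c • x) = φ c • κ.coeffTwistReduce hu hu' φ hφ f x :=
  coeffTwistReduceLinear_smul φ _ c x

/-- `coeffTwistReduce` is surjective when `φ` and `f` are. [cite: Howard2004HeegnerKolyvagin, Rem. 1.2.4] -/
theorem coeffTwistReduce_surjective (f : ρ.toContRepresentation →ⁱL ρ'.toContRepresentation)
    (hφs : Function.Surjective φ) (hf : Function.Surjective f) :
    Function.Surjective (κ.coeffTwistReduce hu hu' φ hφ f) := by
  intro y
  induction y using CoeffExtension.induction_on with
  | zero => exact ⟨0, map_zero _⟩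
  | tmul c a =>
    obtain ⟨c', rfl⟩ := hφs c
    obtain ⟨a', rfl⟩ := hf a
    exact ⟨CoeffExtension.tmul c' a', κ.coeffTwistReduce_tmul hu hu' φ hφ f c' a'⟩
  | add x y hx hy =>
    obtain ⟨x', rfl⟩ := hx
    obtain ⟨y', rfl⟩ := hy
    exact ⟨x' + y', map_add _ _ _⟩

/-- **Naturality of the control maps under change of coefficients**: for `N ≤ Γ_J ⊓ Γ_{J′}` open of finite index,
`H¹(coeffTwistReduce φ f) ∘ coresCoeff_A = coresCoeff_{A′} ∘ H¹(N, f)` (`cor` is natural in the coefficients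
and `reduce (1 ⊗ a) = 1 ⊗ f a`). With `A′ = A_{m,k}` the right-hand side is `coresEisenstein ∘ H¹(N, f)`
(`coresCoeff_eisenstein`): the Λ-adic source level maps followed by Howard's ring change `Λ → S_𝔮` ARE D1's
finite-level control maps. [cite: Howard2004HeegnerKolyvagin, Rem. 1.2.4 and proof of Thm. 2.2.10 (arXiv Thm. 3.2.10, first sentence: KS(𝐓, F_Λ, 𝓛) → KS(T_𝔭, F_𝔭, 𝓛))]
[cite: SerreGaloisCohomology1997, I §2.4] -/
theorem map_coeffTwistReduce_coresCoeff (f : ρ.toContRepresentation →ⁱL ρ'.toContRepresentation)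
    (N : Subgroup (absoluteGaloisGroup K)) (hN : N ≤ κ.layerSubgroup J) (hN' : N ≤ κ.layerSubgroup J')
    (hNo : IsOpen (N : Set (absoluteGaloisGroup K))) [Fintype (absoluteGaloisGroup K ⧸ N)]
    (c : continuousCohomology 1 (subgroupRep ρ.toTopRep N)) :
    galoisCohomology.map (κ.coeffTwistReduce hu hu' φ hφ f) 1 (κ.coresCoeff ρ hu N hN hNo c) =
      κ.coresCoeff ρ' hu' N hN' hNo
        (cohomologyMap (subgroupRepHom (TopRep.ofHom ⟨f.toContinuousLinearMap, f.isIntertwining'⟩) N) 1 c) := by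
  obtain ⟨ψ, rfl⟩ := oneCocycleClass_surjective _ c
  set R : (κ.coeffTwist ρ u J hu).toTopRep ⟶ (κ.coeffTwist ρ' u' J' hu').toTopRep :=
    TopRep.ofHom ⟨(κ.coeffTwistReduce hu hu' φ hφ f).toContinuousLinearMap,
      (κ.coeffTwistReduce hu hu' φ hφ f).isIntertwining'⟩ with hR
  change cohomologyMap R 1 (cores _ _ _ (cohomologyMap (κ.coeffUnitHom ρ hu N hN) 1 (oneCocycleClass _ ψ))) =
    cores _ _ _ (cohomologyMap (κ.coeffUnitHom ρ' hu' N hN') 1 (cohomologyMap _ 1 (oneCocycleClass _ ψ)))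
  have hinner : cohomologyMap (subgroupRepHom R N) 1
        (cohomologyMap (κ.coeffUnitHom ρ hu N hN) 1 (oneCocycleClass _ ψ)) =
      cohomologyMap (κ.coeffUnitHom ρ' hu' N hN') 1
        (cohomologyMap (subgroupRepHom (TopRep.ofHom ⟨f.toContinuousLinearMap, f.isIntertwining'⟩) N) 1
          (oneCocycleClass _ ψ)) := by
    rw [cohomologyMap_oneCocycleClass, cohomologyMap_oneCocycleClass, cohomologyMap_oneCocycleClass,
      cohomologyMap_oneCocycleClass]
    refine congrArg _ (Subtype.ext (ContinuousMap.ext fun x ↦ ?_))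
    rw [pullback_id_resIdHom_apply, pullback_id_resIdHom_apply, pullback_id_resIdHom_apply,
      pullback_id_resIdHom_apply, subgroupRepHom_hom_apply, coeffUnitHom_hom_apply, coeffUnitHom_hom_apply,
      subgroupRepHom_hom_apply]
    change κ.coeffTwistReduce hu hu' φ hφ f (coeffUnit A (ψ.1 x)) = coeffUnit A' (f (ψ.1 x))
    rw [coeffUnit_apply, coeffUnit_apply, coeffTwistReduce_tmul, map_one]
  rw [cohomologyMap_cores, hinner]

end Reduce

end ZpExtension

end Literature.NumberTheory.EllipticCurves

end
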